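import Literature.AnabelianGeometry.SemiGraphs.Coverticial
import Literature.AnabelianGeometry.Anabelioids.ProSigmaProofs
import Literature.GroupTheory.CombinatorialGroupTheory.FreeGroupResiduallyP
import Mathlib.Data.ZMod.QuotientGroup
import Mathlib.GroupTheory.FreeGroup.IsFreeGroup
import Mathlib.GroupTheory.FreeGroup.CyclicallyReduced
import Mathlib.Topology.Algebra.Group.Basic
import HarnessLib

/-!
# Pro-`Σ` completions of free groups are injective on the free group

[SemiAnbd] Example 2.10 (p. 31) works with "the maximal pro-`Σ` quotient of the fundamental group" of a
hyperbolic Riemann surface (abc-iut-L3-t1's `SemiGraphOfAnabelioids.IsProSigmaCompletion Sigma ι`,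
`Coverticial.lean`) and with the closures of the cusp inertia subgroups inside it
[cite: MochizukiSemiAnbd2006, Ex. 2.10 p.31]; [IUTchI] §2 writes "since `F` is residually finite …
`F ⊆ F̂`" (kurims p. 56).  This file records the pro-`Σ` form of that embedding for FREE groups:

* `ker_le_of_isSigmaInteger_index` — the kernel of any pro-`Σ` completion `ι : Γ → P` lies in every
  normal subgroup of `Γ` of `Σ`-integer index;
* `injective_of_isFreeGroup` — if `Γ` is free and `Σ` contains a prime `p`, then `ι` is INJECTIVE
  (free groups are residually `p`: abc-iut-L3-t6's `FreeGroup.exists_normal_index_prime_pow_notMem`);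
* `infinite_topologicalClosure_map_zpowers` — hence for `1 ≠ c ∈ Γ` the closed procyclic subgroup
  `closure ι⟨c⟩` is infinite (free groups are torsion-free) — the "`I_i` is infinite" clause of the cusp
  inertia fact `ProSigmaCuspInertiaMalnormal` (abc-iut-L3-t11, `SurfaceTypeEstranged.lean`) for every
  nontrivial `c`.

Theorems only; plain group theory; no side is taken on [IUTchIII] Cor. 3.12.
-/

namespace Literature.AnabelianGeometry.SemiGraphs.SemiGraphOfAnabelioids.IsProSigmaCompletion

open Literature.AnabelianGeometry.Anabelioids Topology

variable {Sigma : Set ℕ} {Γ : Type*} [Group Γ] {P : Type*} [Group P] [TopologicalSpace P]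
  {ι : Γ →* P}

/-- The kernel of a pro-`Σ` completion lies in every normal subgroup of `Σ`-integer index (such a
subgroup is the pull-back of an open subgroup of `P`). [cite: MochizukiSemiAnbd2006, Ex. 2.10 p.31] -/
theorem ker_le_of_isSigmaInteger_index (hι : IsProSigmaCompletion Sigma ι) (N : Subgroup Γ)
    [N.Normal] (hN : IsSigmaInteger Sigma N.index) : ι.ker ≤ N := by
  obtain ⟨U, -, hU⟩ := hι.comap_surj N inferInstance hN
  intro γ hγ
  rw [← hU, Subgroup.mem_comap, (MonoidHom.mem_ker).mp hγ]
  exact U.one_mem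

/-- A prime power `p ^ k` with `p ∈ Σ` prime is a `Σ`-integer. [cite: MochizukiSemiAnbd2006, Def. 2.9(i) p.31] -/
theorem isSigmaInteger_prime_pow {p : ℕ} (hp : p.Prime) (hpS : p ∈ Sigma) (k : ℕ) :
    IsSigmaInteger Sigma (p ^ k) :=
  ⟨Nat.pow_pos hp.pos, fun q hq hdvd => by
    rwa [(Nat.prime_dvd_prime_iff_eq hq hp).mp (hq.dvd_of_dvd_pow hdvd)]⟩

/-- **A pro-`Σ` completion of a FREE group is injective on it**, provided `Σ` contains a prime `p`:
free groups are residually `p` (abc-iut-L3-t6, `FreeGroup.exists_normal_index_prime_pow_notMem`), so a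
nontrivial element survives in a normal quotient of `p`-power — hence `Σ`-integer — index, which
factors through `P`.  (The pro-`Σ` form of "`F ⊆ F̂`", [IUTchI] §2 p. 56.)
[cite: MochizukiSemiAnbd2006, Ex. 2.10 p.31] -/
theorem injective_of_isFreeGroup [IsFreeGroup Γ] (hι : IsProSigmaCompletion Sigma ι)
    (hp : ∃ p ∈ Sigma, p.Prime) : Function.Injective ι := by
  classical
  obtain ⟨p, hpS, hp⟩ := hp
  rw [← MonoidHom.ker_eq_bot_iff, eq_bot_iff]
  intro γ hγ
  rw [Subgroup.mem_bot]
  by_contra hne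
  let e := IsFreeGroup.toFreeGroup Γ
  have hw : e γ ≠ 1 := fun h => hne (e.injective (h.trans (map_one e).symm))
  obtain ⟨N, k, hNn, hNi, hw⟩ := FreeGroup.exists_normal_index_prime_pow_notMem hp (e γ) hw
  haveI := hNn
  -- pull `N` back to `Γ`: normal of index `p ^ k`, a `Σ`-integer
  let N' : Subgroup Γ := N.comap e.toMonoidHom
  haveI : N'.Normal := Subgroup.Normal.comap hNn _
  have hidx : N'.index = p ^ k := by
    rw [← hNi]
    exact N.index_comap_of_surjective (f := e.toMonoidHom) e.surjective
  have hle := ker_le_of_isSigmaInteger_index hι N' (hidx ▸ isSigmaInteger_prime_pow hp hpS k)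
  exact hw (hle hγ)

/-- In a free group no nontrivial element has finite order. [cite: LyndonSchupp2001, Ch. I Prop. 2.17] -/
theorem not_isOfFinOrder_of_isFreeGroup {G : Type*} [Group G] [IsFreeGroup G] {c : G} (hc : c ≠ 1) :
    ¬ IsOfFinOrder c := by
  intro hfin
  obtain ⟨n, hn, hcn⟩ := hfin.exists_pow_eq_one
  let e := IsFreeGroup.toFreeGroup G
  have h1 : (e c) ^ n = 1 := by rw [← map_pow, hcn, map_one]
  exact hc (e.injective (((pow_eq_one_iff_left hn.ne').mp h1).trans (map_one e).symm))

/-- **Closed procyclic subgroups generated by nontrivial elements are infinite.**  For `Γ` free, `Σ`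
containing a prime, `ι : Γ → P` a pro-`Σ` completion and `1 ≠ c ∈ Γ`, the closure of `ι⟨c⟩` in `P` is
infinite (`ι` is injective and `c` has infinite order).  This is the first clause ("`I_i` is infinite") of
the cusp-inertia fact used for [SemiAnbd] Ex. 2.10 "totally estranged", for any nontrivial `c`.
[cite: MochizukiSemiAnbd2006, Ex. 2.10 p.31] -/
theorem infinite_topologicalClosure_map_zpowers [IsTopologicalGroup P] [IsFreeGroup Γ]
    (hι : IsProSigmaCompletion Sigma ι) (hp : ∃ p ∈ Sigma, p.Prime) {c : Γ} (hc : c ≠ 1) :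
    Infinite ((Subgroup.zpowers c).map ι).topologicalClosure := by
  have hinj := injective_of_isFreeGroup hι hp
  -- `ι c` has infinite order
  have hord : ¬ IsOfFinOrder (ι c) := by
    intro hfin
    apply not_isOfFinOrder_of_isFreeGroup hc
    obtain ⟨n, hn, hcn⟩ := hfin.exists_pow_eq_one
    refine isOfFinOrder_iff_pow_eq_one.mpr ⟨n, hn, hinj ?_⟩
    rw [map_pow, hcn, map_one]
  have hinf : ((Subgroup.zpowers (ι c) : Subgroup P) : Set P).Infinite := infinite_zpowers.mpr hord
  have hsub : ((Subgroup.zpowers (ι c) : Subgroup P) : Set P) ⊆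
      (((Subgroup.zpowers c).map ι).topologicalClosure : Set P) := by
    rw [← MonoidHom.map_zpowers]
    exact Subgroup.le_topologicalClosure _
  exact Set.infinite_coe_iff.mpr (hinf.mono hsub)

end Literature.AnabelianGeometry.SemiGraphs.SemiGraphOfAnabelioids.IsProSigmaCompletion
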